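import Summits.Ventures.Crystal3D.Theorems.StickyWulffConstantTextureBuildExposedFacets
import Summits.Ventures.Crystal3D.Theorems.StickyWulffConstantTextureBuildCoplanarFacets
import HarnessLib

/-!
# TB-D assembly, part 7b: LEDGER SPLITTING, FREE HALF — exposed facets are paid by the tent zones' localized perimeters and the designated regions
# (lane T, crux `TextureLiminfV5`, stmt-Ventures-23912; repair census HOME/wulff-p2/g20/TB-D-1-g20.md §2 (d)(e), §4 brick B10)

HONEST FRAMING. Venture `Summits/Ventures/Crystal3D` (cell `crystal3d-full`), route `route-Ventures-StickyWulffConstant`, helper `--supports` the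
law-v5 crux `TextureLiminfV5` (stmt-Ventures-23912).  Pure continuum bookkeeping (census-free, standard axioms) for the `PieceData` construction behind
`stub_TB_energy`: the FREE line of the piece ledger (`energy_le_pieceLedger`, …TextureBuildPieceEnergy) is bounded from a CLASSIFICATION of exposed facet
points.  Nothing about any cover or mesh; F-C1 not moved.

SETTING.  Pieces `P μ = polytope (Hp μ)` (bounded, unit normals, distinct facet planes, pairwise disjoint) with classes `cls μ : Fin n`; a body `K ℓ`
per class (compact, convex, `∋ 0`, support function `≤ κW` on unit vectors); OPEN tent zones `V ℓ`; finitely many DESIGNATED planar regions `Φ d`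
(closed, bounded, inside the plane `{⟪nrm d, x⟫ = lvl d}`, `‖nrm d‖ = 1`).  The exposed part of the facet `p` of piece `μ` is
`E μ p := (cl P μ ∩ {⟪p.1,x⟫ = p.2}) ∖ ⋃_{μ' ≠ μ} cl P μ'`.
HYPOTHESIS (P1).  For every piece facet, the exposed part lies — up to a `facetArea`-null set — in its class's tent zone or in a designated region
carried by the SAME oriented plane: `facetArea (E μ p ∖ (V (cls μ) ∪ ⋃_{d : (nrm d, lvl d) = p} Φ d)) p.1 = 0`.
CONCLUSION (`free_le_split`).
  `Σ_μ Σ_{p ∈ Hp μ} h_{K(cls μ)}(p.1)·facetArea (E μ p) p.1 ≤ Σ_ℓ (perKIn (K ℓ) (⋃_μ P μ) (V ℓ)).toReal + κW · Σ_d facetArea (Φ d) (nrm d)`.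
PROOF.  Per facet, `facetArea (E) ≤ facetArea (E ∩ V) + Σ_{matching d} facetArea (cl P μ ∩ Φ d)` (finite cover + (P1)); the tent part of class `ℓ` is at most
the sum over ALL pieces of `h_{K ℓ}·facetArea (E ∩ V ℓ)`, which `exposedFacetSumIn_le_perKIn` (p713072) bounds by `perKIn (K ℓ) (⋃ P) (V ℓ)`; the designated
part is re-indexed by `d` and, since all pieces carrying the oriented half-space `(nrm d, lvl d)` lie on ONE side of the plane, their traces on `Φ d` add up
(`sum_facetArea_inter_le_of_sameSide`, p711205).
-/

noncomputable section

namespace Summit.Ventures.Crystal3D.Cruxes.TextureLiminf.TexShadow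

open Summit.Ventures.Crystal3D Summit.Ventures.Crystal3D.Theorems MeasureTheory Set
open scoped InnerProductSpace

/-- Re-indexing a facet sum restricted to ONE oriented half-space datum `q`: `Σ_{p ∈ H, p = q} g p = [q ∈ H]·g q`. -/
theorem sum_filter_eq_pair {H : Finset (E3 × ℝ)} (q : E3 × ℝ) (g : E3 × ℝ → ℝ) :
    ∑ p ∈ H.filter (fun p => p.1 = q.1 ∧ p.2 = q.2), g p = if q ∈ H then g q else 0 := by
  classical
  have hf : H.filter (fun p => p.1 = q.1 ∧ p.2 = q.2) = H.filter (fun p => p = q) := by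
    refine Finset.filter_congr fun p _ => ?_
    constructor
    · rintro ⟨h1, h2⟩; exact Prod.ext h1 h2
    · rintro rfl; exact ⟨rfl, rfl⟩
  rw [hf, Finset.filter_eq', ]
  split_ifs with h
  · simp
  · simp

/-- **LEDGER SPLITTING, FREE HALF.**  See the module docstring. -/
theorem free_le_split {n M : ℕ} (K : Fin n → Set E3) (hKc : ∀ ℓ, IsCompact (K ℓ)) (hKv : ∀ ℓ, Convex ℝ (K ℓ))
    (hK0 : ∀ ℓ, (0 : E3) ∈ K ℓ) {κW : ℝ} (hκW : 0 ≤ κW) (hKW : ∀ ℓ (ν : E3), ‖ν‖ = 1 → supportFn (K ℓ) ν ≤ κW)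
    (Hp : Fin M → Finset (E3 × ℝ)) (cls : Fin M → Fin n)
    (hbd : ∀ μ, Bornology.IsBounded (polytope (Hp μ)))
    (hunit : ∀ μ, ∀ p ∈ Hp μ, ‖p.1‖ = 1)
    (hplanes : ∀ μ, ∀ p ∈ Hp μ, ∀ p' ∈ Hp μ, p ≠ p' →
      {x : E3 | ⟪p.1, x⟫_ℝ = p.2} ≠ {x : E3 | ⟪p'.1, x⟫_ℝ = p'.2})
    (hdisj : ∀ μ μ', μ ≠ μ' → Disjoint (polytope (Hp μ)) (polytope (Hp μ')))
    {ι : Type*} (dS : Finset ι) (Φ : ι → Set E3) (nrm : ι → E3) (lvl : ι → ℝ)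
    (hΦ : ∀ d ∈ dS, Φ d ⊆ {x : E3 | ⟪nrm d, x⟫_ℝ = lvl d}) (hnrm : ∀ d ∈ dS, ‖nrm d‖ = 1)
    (hΦc : ∀ d ∈ dS, IsClosed (Φ d)) (hΦb : ∀ d ∈ dS, Bornology.IsBounded (Φ d))
    (V : Fin n → Set E3) (hV : ∀ ℓ, IsOpen (V ℓ))
    (hVfin : ∀ ℓ, perKIn (K ℓ) (⋃ μ, polytope (Hp μ)) (V ℓ) ≠ ⊤)
    (hP1 : ∀ μ, ∀ p ∈ Hp μ,
      facetArea (((closure (polytope (Hp μ)) ∩ {x : E3 | ⟪p.1, x⟫_ℝ = p.2}) \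
          ⋃ μ' ∈ Finset.univ.erase μ, closure (polytope (Hp μ'))) \
        (V (cls μ) ∪ ⋃ d ∈ dS.filter (fun d => nrm d = p.1 ∧ lvl d = p.2), Φ d)) p.1 = 0) :
    (∑ μ, ∑ p ∈ Hp μ, supportFn (K (cls μ)) p.1 *
        facetArea ((closure (polytope (Hp μ)) ∩ {x : E3 | ⟪p.1, x⟫_ℝ = p.2}) \
          ⋃ μ' ∈ Finset.univ.erase μ, closure (polytope (Hp μ'))) p.1) ≤
      (∑ ℓ, (perKIn (K ℓ) (⋃ μ, polytope (Hp μ)) (V ℓ)).toReal) + κW * ∑ d ∈ dS, facetArea (Φ d) (nrm d) := by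
  classical
  -- names for the exposed sets
  set E : Fin M → (E3 × ℝ) → Set E3 := fun μ p =>
    ((closure (polytope (Hp μ)) ∩ {x : E3 | ⟪p.1, x⟫_ℝ = p.2}) \ ⋃ μ' ∈ Finset.univ.erase μ, closure (polytope (Hp μ'))) with hE
  have hEsub : ∀ μ p, E μ p ⊆ closure (polytope (Hp μ)) := fun μ p x hx => hx.1.1
  have hsupp0 : ∀ ℓ (ν : E3), 0 ≤ supportFn (K ℓ) ν := by
    intro ℓ ν
    unfold supportFn
    have hb : BddAbove ((fun y : E3 => ⟪y, ν⟫_ℝ) '' K ℓ) := ((hKc ℓ).image (continuous_id.inner continuous_const)).bddAbove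
    simpa using le_csSup hb ⟨0, hK0 ℓ, by simp⟩
  have hh0 : ∀ μ (p : E3 × ℝ), 0 ≤ supportFn (K (cls μ)) p.1 := fun μ p => hsupp0 _ _
  have hfa0 : ∀ (S : Set E3) (ν : E3), 0 ≤ facetArea S ν := fun _ _ => ENNReal.toReal_nonneg
  -- STEP 1: per facet, the finite cover
  have hstep1 : ∀ μ, ∀ p ∈ Hp μ, facetArea (E μ p) p.1 ≤
      facetArea (E μ p ∩ V (cls μ)) p.1 + ∑ d ∈ dS.filter (fun d => nrm d = p.1 ∧ lvl d = p.2), facetArea (closure (polytope (Hp μ)) ∩ Φ d) p.1 := by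
    intro μ p hp
    -- cover `E` by `E ∩ V`, the matching `cl P ∩ Φ d`, and the null rest; index set `Option ι` restricted
    set Dp := dS.filter (fun d => nrm d = p.1 ∧ lvl d = p.2) with hDp
    set G : Option ι → Set E3 := fun o => match o with
      | none => (E μ p ∩ V (cls μ)) ∪ (E μ p \ (V (cls μ) ∪ ⋃ d ∈ Dp, Φ d))
      | some d => closure (polytope (Hp μ)) ∩ Φ d with hG
    have hcover : E μ p ⊆ ⋃ o ∈ insert none (Dp.image some), G o := by
      intro x hx
      by_cases hxV : x ∈ V (cls μ)
      · exact mem_iUnion₂.2 ⟨none, Finset.mem_insert_self _ _, Or.inl ⟨hx, hxV⟩⟩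
      by_cases hxD : x ∈ ⋃ d ∈ Dp, Φ d
      · obtain ⟨d, hd, hxd⟩ := mem_iUnion₂.1 hxD
        exact mem_iUnion₂.2 ⟨some d, Finset.mem_insert_of_mem (Finset.mem_image_of_mem _ hd), (hEsub μ p hx), hxd⟩
      · exact mem_iUnion₂.2 ⟨none, Finset.mem_insert_self _ _, Or.inr ⟨hx, fun h => h.elim hxV hxD⟩⟩
    have hfin : ∀ o ∈ insert none (Dp.image some), volume {x : E3 | ∃ y ∈ G o, ∃ t ∈ Set.Icc (0 : ℝ) 1, x = y + t • p.1} ≠ ⊤ := by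
      intro o _
      rcases o with _ | d
      · refine volume_prism_ne_top_of_isBounded (hbd μ) _ (fun x hx => ?_) p.1
        rcases hx with hx | hx
        · exact hEsub μ p hx.1
        · exact hEsub μ p hx.1
      · exact volume_prism_ne_top_of_isBounded (hbd μ) _ (fun x hx => hx.1) p.1
    have h1 := facetArea_le_sum_of_subset_iUnion (insert none (Dp.image some)) (E μ p) G p.1 hcover hfin
    have hnotmem : none ∉ Dp.image some := by simp
    rw [Finset.sum_insert hnotmem, Finset.sum_image (fun d _ d' _ h => Option.some_injective _ h)] at h1
    -- the `none` term: `E ∩ V` plus the null rest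
    have hnone : facetArea (G none) p.1 ≤ facetArea (E μ p ∩ V (cls μ)) p.1 + 0 := by
      have h2 := facetArea_le_sum_of_subset_iUnion (Finset.univ : Finset Bool) (G none)
        (fun b => cond b (E μ p ∩ V (cls μ)) (E μ p \ (V (cls μ) ∪ ⋃ d ∈ Dp, Φ d))) p.1 ?_ ?_
      · have hrest : facetArea (E μ p \ (V (cls μ) ∪ ⋃ d ∈ Dp, Φ d)) p.1 = 0 := hP1 μ p hp
        simpa [Fintype.sum_bool, hrest] using h2
      · intro x hx
        rcases hx with hx | hx
        · exact mem_iUnion₂.2 ⟨true, Finset.mem_univ _, hx⟩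
        · exact mem_iUnion₂.2 ⟨false, Finset.mem_univ _, hx⟩
      · intro b _
        cases b
        · exact volume_prism_ne_top_of_isBounded (hbd μ) _ (fun x hx => hEsub μ p hx.1) p.1
        · exact volume_prism_ne_top_of_isBounded (hbd μ) _ (fun x hx => hEsub μ p hx.1) p.1
    have hsome : ∑ d ∈ Dp, facetArea (G (some d)) p.1 = ∑ d ∈ Dp, facetArea (closure (polytope (Hp μ)) ∩ Φ d) p.1 := rfl
    linarith
  -- STEP 2: multiply by the weights and sum
  have hstep2 : (∑ μ, ∑ p ∈ Hp μ, supportFn (K (cls μ)) p.1 * facetArea (E μ p) p.1) ≤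
      (∑ μ, ∑ p ∈ Hp μ, supportFn (K (cls μ)) p.1 * facetArea (E μ p ∩ V (cls μ)) p.1) +
      ∑ μ, ∑ p ∈ Hp μ, supportFn (K (cls μ)) p.1 *
        ∑ d ∈ dS.filter (fun d => nrm d = p.1 ∧ lvl d = p.2), facetArea (closure (polytope (Hp μ)) ∩ Φ d) p.1 := by
    rw [← Finset.sum_add_distrib]
    refine Finset.sum_le_sum fun μ _ => ?_
    rw [← Finset.sum_add_distrib]
    refine Finset.sum_le_sum fun p hp => ?_
    rw [← mul_add]
    exact mul_le_mul_of_nonneg_left (hstep1 μ p hp) (hh0 μ p)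
  -- STEP 3: the tent part, class by class, via `exposedFacetSumIn_le_perKIn`
  have hstep3 : (∑ μ, ∑ p ∈ Hp μ, supportFn (K (cls μ)) p.1 * facetArea (E μ p ∩ V (cls μ)) p.1) ≤
      ∑ ℓ, (perKIn (K ℓ) (⋃ μ, polytope (Hp μ)) (V ℓ)).toReal := by
    rw [← Finset.sum_fiberwise Finset.univ cls
      (fun μ => ∑ p ∈ Hp μ, supportFn (K (cls μ)) p.1 * facetArea (E μ p ∩ V (cls μ)) p.1)]
    refine Finset.sum_le_sum fun ℓ _ => ?_
    have hall : (∑ μ ∈ Finset.univ.filter (fun μ => cls μ = ℓ), ∑ p ∈ Hp μ, supportFn (K (cls μ)) p.1 * facetArea (E μ p ∩ V (cls μ)) p.1) ≤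
        ∑ μ, ∑ p ∈ Hp μ, supportFn (K ℓ) p.1 * facetArea (E μ p ∩ V ℓ) p.1 := by
      calc (∑ μ ∈ Finset.univ.filter (fun μ => cls μ = ℓ), ∑ p ∈ Hp μ, supportFn (K (cls μ)) p.1 * facetArea (E μ p ∩ V (cls μ)) p.1)
          = ∑ μ ∈ Finset.univ.filter (fun μ => cls μ = ℓ), ∑ p ∈ Hp μ, supportFn (K ℓ) p.1 * facetArea (E μ p ∩ V ℓ) p.1 :=
            Finset.sum_congr rfl fun μ hμ => by rw [(Finset.mem_filter.1 hμ).2]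
        _ ≤ ∑ μ, ∑ p ∈ Hp μ, supportFn (K ℓ) p.1 * facetArea (E μ p ∩ V ℓ) p.1 :=
            Finset.sum_le_sum_of_subset_of_nonneg (Finset.filter_subset _ _) fun μ _ _ =>
              Finset.sum_nonneg fun p _ => mul_nonneg (hsupp0 _ _) (hfa0 _ _)
    refine hall.trans ?_
    have hex := exposedFacetSumIn_le_perKIn Hp hbd hunit hplanes hdisj (hV ℓ) (hKc ℓ) (hKv ℓ) (hK0 ℓ)
    have hsum0 : 0 ≤ ∑ μ, ∑ p ∈ Hp μ, supportFn (K ℓ) p.1 * facetArea (E μ p ∩ V ℓ) p.1 :=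
      Finset.sum_nonneg fun μ _ => Finset.sum_nonneg fun p _ => mul_nonneg (hsupp0 _ _) (hfa0 _ _)
    exact (ENNReal.ofReal_le_iff_le_toReal (hVfin ℓ)).1 hex
  -- STEP 4: the designated part, re-indexed by `d`, via one-side additivity
  have hstep4 : (∑ μ, ∑ p ∈ Hp μ, supportFn (K (cls μ)) p.1 *
        ∑ d ∈ dS.filter (fun d => nrm d = p.1 ∧ lvl d = p.2), facetArea (closure (polytope (Hp μ)) ∩ Φ d) p.1) ≤
      κW * ∑ d ∈ dS, facetArea (Φ d) (nrm d) := by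
    -- weights ≤ κW
    have hw : (∑ μ, ∑ p ∈ Hp μ, supportFn (K (cls μ)) p.1 *
          ∑ d ∈ dS.filter (fun d => nrm d = p.1 ∧ lvl d = p.2), facetArea (closure (polytope (Hp μ)) ∩ Φ d) p.1) ≤
        ∑ μ, ∑ p ∈ Hp μ, κW * ∑ d ∈ dS.filter (fun d => nrm d = p.1 ∧ lvl d = p.2), facetArea (closure (polytope (Hp μ)) ∩ Φ d) p.1 :=
      Finset.sum_le_sum fun μ _ => Finset.sum_le_sum fun p hp =>
        mul_le_mul_of_nonneg_right (hKW _ _ (hunit μ p hp)) (Finset.sum_nonneg fun d _ => hfa0 _ _)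
    refine hw.trans ?_
    -- swap `p` and `d`
    have hswap : ∀ μ, (∑ p ∈ Hp μ, κW * ∑ d ∈ dS.filter (fun d => nrm d = p.1 ∧ lvl d = p.2), facetArea (closure (polytope (Hp μ)) ∩ Φ d) p.1) =
        κW * ∑ d ∈ dS, (if (nrm d, lvl d) ∈ Hp μ then facetArea (closure (polytope (Hp μ)) ∩ Φ d) (nrm d) else 0) := by
      intro μ
      rw [← Finset.mul_sum]
      congr 1
      rw [Finset.sum_comm' (t' := dS) (s' := fun d => (Hp μ).filter (fun p => p.1 = nrm d ∧ p.2 = lvl d))]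
      · refine Finset.sum_congr rfl fun d _ => ?_
        rw [sum_filter_eq_pair (nrm d, lvl d) (fun p => facetArea (closure (polytope (Hp μ)) ∩ Φ d) p.1)]
      · intro p d
        simp only [Finset.mem_filter]
        constructor
        · rintro ⟨hp, hd, h1, h2⟩; exact ⟨⟨hp, h1.symm, h2.symm⟩, hd⟩
        · rintro ⟨⟨hp, h1, h2⟩, hd⟩; exact ⟨hp, hd, h1.symm, h2.symm⟩
    simp only [hswap]
    rw [← Finset.mul_sum, Finset.sum_comm]
    refine mul_le_mul_of_nonneg_left (Finset.sum_le_sum fun d hd => ?_) hκW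
    rw [← Finset.sum_filter]
    have hs : ∀ μ ∈ Finset.univ.filter (fun μ => (nrm d, lvl d) ∈ Hp μ), polytope (Hp μ) ⊆ {x : E3 | ⟪nrm d, x⟫_ℝ < lvl d} := by
      intro μ hμ x hx
      have hmem := (Finset.mem_filter.1 hμ).2
      simp only [polytope, mem_iInter, mem_setOf_eq] at hx
      exact hx _ hmem
    exact sum_facetArea_inter_le_of_sameSide (Finset.univ.filter (fun μ => (nrm d, lvl d) ∈ Hp μ)) Hp (hnrm d hd) hs
      (fun μ _ μ' _ hne => hdisj μ μ' hne) (hΦ d hd) (hΦc d hd) (hΦb d hd)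
  linarith [hstep2, hstep3, hstep4]

end Summit.Ventures.Crystal3D.Cruxes.TextureLiminf.TexShadow

end
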